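import Summits.QuantumFields.YangMills.Theorems.SwapVirialDeficitSectorLaplaceEndGaussPlugRate
import HarnessLib

/-!
# THE PLUG OF `stub_end_gaussCore` (memo-ε), PART 2: ★★ the tail part is absorbed into the Morse–Bott main term
# (skeleton ➎ of cell ym-idea-1; free-hands support of ⟨stmt-QuantumFields-24197⟩ `SwapVirialDeficit.SwapGluedStiffness`; w3 g67 memo-ε step 4)

The TAIL part `κ_L·coneConst·π·K(c)·T·(36 τ^{1/6} + π²√τ)` of the plug, with the socket's tail bound `T ≤ e^{CT·L^pT − b·τ^qT/(QT·L^pT)}`, is at most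
`(1/256)·(2π/b)^α·M_ε` above a polynomial threshold `b ≥ K_T·L^{k_T}·τ⁻¹^{k_T}`:
* `tail_absorb` — the abstract form (factors `κ ≤ 9L⁴`, `Kc ≤ KcB`, `Sg ≤ 46`, threshold `b^{1/4}(4(9L⁴+1) + M) ≤ X`; ✓`exp_absorb` against ✓`bulkMass_exp_floor`,
  `Q + 1 ≤ e^Q`, `256 ≤ e⁶`);
* ★★ `tailPart_le` — the concrete form with `K_T = (1 + W₀·QT)²`, `k_T = 2(28+2pT) + 2qT` (`K(c) ≤ π⁴(2C₃+1)331200⁴L²⁴` for `b ≥ 1` by ✓`leaderK_common_le`,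
  `b^{3/4} ≥ √b ≥ Y`).

HONEST LABEL: bookkeeping toward the plug of `stub_end_gaussCore`; until (P) (w3 g68 ✓`endGauss_params` / LEAD ✓`endGauss_N2_of_params`) and the plug land and the
skeleton is flipped, `stub_end_gaussCore` is OPEN; `stub_core_tip`, ⟨24197⟩ ∕ ⟨24194⟩ OPEN; item of record ⟨24085⟩ `SubOctaveBounded` aside ∕ untouched; the Yang–Mills
mass gap is NOT proved; no summit is proved by a line.  THEOREMS ONLY (0 `def`, 0 `sorry`), standard axioms, no instances beyond the series' local `ℍ` ones.
Seat ym-line-fcl-p3 g49 (cell ym-idea-1, free hands = ➎ assembler), `--supports stmt-QuantumFields-24197`.  References: [cite: Luscher1983, §2]; [folklore].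
-/

set_option autoImplicit false
set_option synthInstance.maxSize 1024

noncomputable section

open MeasureTheory Quaternion Set Module
open scoped Quaternion BigOperators ENNReal InnerProductSpace
open Literature.MathematicalPhysics.QuantumLattice
open Literature.MathematicalPhysics.QuantumFieldTheory hiding SU2
open Summit.QuantumFields.YangMills.Theorems.SwapTwistDeficit.ToronLog

namespace Summit.QuantumFields.YangMills.Theorems.SwapVirialDeficit.SectorLaplace

open Summit.QuantumFields.YangMills.Theorems.FemtoTransferGap
open Summit.QuantumFields.YangMills.Theorems.FemtoTransferGap.TT
open Summit.QuantumFields.YangMills.Theorems.VirialFluxGap.RingDeficit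
open Summit.QuantumFields.YangMills.Theorems.SwapVirialDeficit.SwapRing
open Summit.QuantumFields.YangMills.Theorems.SwapVirialDeficit.BlowUpRing
open Summit.QuantumFields.YangMills.Theorems.SwapVirialDeficit.Gnomonic (gnomonicWeight normSq3)

variable {L : ℕ} [NeZero L]

/-! ## §1 ★★ The tail part is absorbed into the main term -/

set_option maxHeartbeats 400000 in
/-- ★ **TAIL ABSORPTION, ABSTRACT FORM**: for good `ε`, `0 < τ ≤ ½`, `b ≥ 1`, factors `κ ≤ 9L⁴`, `0 ≤ Kc ≤ KcB`, `0 ≤ Sg ≤ 46` and a tail exponent `X` above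
the threshold `b^{1/4}·(4(9L⁴+1) + M) ≤ X`, `M = |log cone(HubBulk ½)| + 183602L⁸ + 6 + Q + |CT|L^pT`, `Q = 9L⁴·coneConst·π·KcB·46`:
`κ·(coneConst·π·(Kc·(e^{CT·L^pT − X}·Sg))) ≤ (1/256)·((2π/b)^α·M_ε)` (✓`exp_absorb` against ✓`bulkMass_exp_floor`, `Q ≤ e^Q`). [folklore] -/
theorem tail_absorb {ε : GnoSign L} (hε : GoodSign ε) {τ : ℝ} (hτ : 0 < τ) (hτ2 : τ ≤ 1 / 2) {b κ Kc KcB Sg CT X : ℝ} {pT : ℕ}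
    (hb1 : 1 ≤ b) (hκ : κ ≤ 9 * (L : ℝ) ^ 4) (hKc0 : 0 ≤ Kc) (hKc : Kc ≤ KcB) (hSg0 : 0 ≤ Sg) (hSg : Sg ≤ 46)
    (hX : b ^ (1 / 4 : ℝ) * (4 * (9 * (L : ℝ) ^ 4 + 1) + (|Real.log (coneMeasure.real (HubBulk (1 / 2)))| + 183602 * (L : ℝ) ^ 8 +
      (6 + 9 * (L : ℝ) ^ 4 * (coneConst * Real.pi) * KcB * 46 + |CT| * (L : ℝ) ^ pT))) ≤ X) :
    κ * (coneConst * Real.pi * (Kc * (Real.exp (CT * (L : ℝ) ^ pT - X) * Sg))) ≤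
      (1 / 256 : ℝ) * ((2 * Real.pi / b) ^ alpha L * ∫ a in HubBulk τ, (∫ p : ℝ × ℝ, mbDensity (L := L) a ε p) ∂coneMeasure) := by
  have hL1 : (1 : ℝ) ≤ L := by exact_mod_cast NeZero.one_le
  have hb0 : 0 < b := by linarith
  have hcc : 0 < coneConst * Real.pi := mul_pos coneConst_pos Real.pi_pos
  have hcH0 : 0 < coneMeasure.real (HubBulk (1 / 2)) := coneMeasure_hubBulk_half_pos
  have hKcB : 0 ≤ KcB := hKc0.trans hKc
  -- the floor
  have hM_lo := bulkMass_exp_floor (L := L) hε hτ hτ2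
  set Mε : ℝ := ∫ a in HubBulk τ, (∫ p : ℝ × ℝ, mbDensity (L := L) a ε p) ∂coneMeasure with hMε
  clear_value Mε
  set cH : ℝ := coneMeasure.real (HubBulk (1 / 2)) with hcH
  clear_value cH
  have hMε0 : 0 ≤ Mε := le_trans (mul_pos hcH0 (Real.exp_pos _)).le hM_lo
  -- `LHS ≤ (Q+1)·e^{CT L^pT}·e^{−X}`
  have eT : Real.exp (CT * (L : ℝ) ^ pT - X) = Real.exp (CT * (L : ℝ) ^ pT) * Real.exp (-X) := by rw [← Real.exp_add]; ring_nf
  obtain ⟨Q, hQ⟩ : ∃ Q : ℝ, Q = 9 * (L : ℝ) ^ 4 * (coneConst * Real.pi) * KcB * 46 := ⟨_, rfl⟩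
  have hQ0 : 0 ≤ Q := by rw [hQ]; positivity
  have hQ1 : 0 < Q + 1 := by linarith
  have hLHS : κ * (coneConst * Real.pi * (Kc * (Real.exp (CT * (L : ℝ) ^ pT - X) * Sg))) ≤ (Q + 1) * Real.exp (CT * (L : ℝ) ^ pT) * Real.exp (-X) := by
    rw [eT]
    have h1 : κ * (coneConst * Real.pi) * Kc * Sg ≤ 9 * (L : ℝ) ^ 4 * (coneConst * Real.pi) * KcB * 46 :=
      mul_le_mul (mul_le_mul (mul_le_mul_of_nonneg_right hκ hcc.le) hKc hKc0 (by positivity)) hSg hSg0 (by positivity)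
    have e1 : κ * (coneConst * Real.pi * (Kc * (Real.exp (CT * (L : ℝ) ^ pT) * Real.exp (-X) * Sg))) =
        (κ * (coneConst * Real.pi) * Kc * Sg) * (Real.exp (CT * (L : ℝ) ^ pT) * Real.exp (-X)) := by ring
    rw [e1, mul_assoc (Q + 1)]
    rw [← hQ] at h1
    exact mul_le_mul_of_nonneg_right (by linarith) (by positivity)
  -- the floor `𝔐 = M_ε/D ≥ e^{−M}`, `D = 256·(Q+1)·e^{CT L^pT} ≤ e^{6 + Q + |CT| L^pT}`
  obtain ⟨D, hD⟩ : ∃ D : ℝ, D = 256 * (Q + 1) * Real.exp (CT * (L : ℝ) ^ pT) := ⟨_, rfl⟩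
  have hD0 : 0 < D := by rw [hD]; positivity
  have hDle : D ≤ Real.exp (6 + Q + |CT| * (L : ℝ) ^ pT) := by
    rw [hD, Real.exp_add, Real.exp_add]
    have h256 : (256 : ℝ) ≤ Real.exp 6 := by
      have h27 : (2.7 : ℝ) ≤ Real.exp 1 := by linarith [Real.exp_one_gt_d9]
      have h6 : Real.exp 6 = (Real.exp 1) ^ 6 := by rw [← Real.exp_nat_mul]; norm_num
      have h7 : (2.7 : ℝ) ^ 6 ≤ (Real.exp 1) ^ 6 := pow_le_pow_left₀ (by norm_num) h27 6
      have h8 : (256 : ℝ) ≤ (2.7 : ℝ) ^ 6 := by norm_num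
      rw [h6]; exact h8.trans h7
    have hQe : Q + 1 ≤ Real.exp Q := Real.add_one_le_exp Q
    have hCT : Real.exp (CT * (L : ℝ) ^ pT) ≤ Real.exp (|CT| * (L : ℝ) ^ pT) :=
      Real.exp_le_exp.2 (mul_le_mul_of_nonneg_right (le_abs_self CT) (by positivity))
    have he2 : 0 ≤ Real.exp 6 * Real.exp Q := by positivity
    exact mul_le_mul (mul_le_mul h256 hQe hQ1.le (Real.exp_pos _).le) hCT (Real.exp_pos _).le he2
  obtain ⟨M, hM⟩ : ∃ M : ℝ, M = |Real.log cH| + 183602 * (L : ℝ) ^ 8 + (6 + Q + |CT| * (L : ℝ) ^ pT) := ⟨_, rfl⟩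
  have hM0 : 0 ≤ M := by rw [hM]; positivity
  have hfloor : Real.exp (-M) ≤ Mε / D := by
    rw [le_div_iff₀ hD0]
    have hcH' : Real.exp (-|Real.log cH|) ≤ cH := by
      calc Real.exp (-|Real.log cH|) ≤ Real.exp (Real.log cH) := Real.exp_le_exp.2 (neg_abs_le _)
        _ = cH := Real.exp_log hcH0
    calc Real.exp (-M) * D ≤ Real.exp (-M) * Real.exp (6 + Q + |CT| * (L : ℝ) ^ pT) := mul_le_mul_of_nonneg_left hDle (Real.exp_pos _).le
      _ = Real.exp (-|Real.log cH|) * Real.exp (-(183602 * (L : ℝ) ^ 8)) := by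
          rw [← Real.exp_add, ← Real.exp_add, hM]; congr 1; ring
      _ ≤ cH * Real.exp (-(183602 * (L : ℝ) ^ 8)) := mul_le_mul_of_nonneg_right hcH' (Real.exp_pos _).le
      _ ≤ Mε := hM_lo
  -- `exp_absorb`
  have he0 : (0 : ℝ) ≤ alpha L := by
    rw [show alpha L = 9 * (L : ℝ) ^ 4 - 1 from by unfold alpha; exact finrank_gnoFibre_real_div_two]; nlinarith [one_le_pow₀ (n := 4) hL1]
  have heE : alpha L ≤ 9 * (L : ℝ) ^ 4 := by
    rw [show alpha L = 9 * (L : ℝ) ^ 4 - 1 from by unfold alpha; exact finrank_gnoFibre_real_div_two]; linarith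
  have hX' : b ^ (1 / 4 : ℝ) * (4 * (9 * (L : ℝ) ^ 4 + 1) + M) ≤ X := by rw [hM, hQ]; exact hX
  have habs := exp_absorb (𝔐 := Mε / D) hb1 he0 heE hM0 hfloor hX'
  have hbq : b ^ (-(1 / 4 : ℝ)) ≤ 1 := Real.rpow_le_one_of_one_le_of_nonpos hb1 (by norm_num)
  have hG0 : 0 ≤ (2 * Real.pi / b) ^ alpha L := Real.rpow_nonneg (by positivity) _
  have hmain0 : 0 ≤ (2 * Real.pi / b) ^ alpha L * (Mε / D) := mul_nonneg hG0 (div_nonneg hMε0 hD0.le)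
  have hexp : Real.exp (-X) ≤ (2 * Real.pi / b) ^ alpha L * (Mε / D) := by
    calc Real.exp (-X) ≤ b ^ (-(1 / 4 : ℝ)) * ((2 * Real.pi / b) ^ alpha L * (Mε / D)) := habs
      _ ≤ 1 * ((2 * Real.pi / b) ^ alpha L * (Mε / D)) := mul_le_mul_of_nonneg_right hbq hmain0
      _ = _ := one_mul _
  refine hLHS.trans ?_
  calc (Q + 1) * Real.exp (CT * (L : ℝ) ^ pT) * Real.exp (-X) ≤ (Q + 1) * Real.exp (CT * (L : ℝ) ^ pT) * ((2 * Real.pi / b) ^ alpha L * (Mε / D)) :=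
        mul_le_mul_of_nonneg_left hexp (by positivity)
    _ = (1 / 256 : ℝ) * ((2 * Real.pi / b) ^ alpha L * Mε) := by
        rw [hD]
        have hne : (Q + 1) * Real.exp (CT * (L : ℝ) ^ pT) ≠ 0 := by positivity
        field_simp

set_option maxHeartbeats 400000 in
/-- ★★ **THE TAIL PART OF THE PLUG IS ABSORBED**: for any tail constants `CT`, `QT > 0`, `pT`, `qT` there are `K_T > 0`, `k_T` such that for good `ε`,
`0 < τ ≤ ½` and `b ≥ K_T·L^{k_T}·τ⁻¹^{k_T}`:
`κ_L·(coneConst·π·(K(c)·(e^{CT·L^pT − b·τ^qT/(QT·L^pT)}·(36(√τ)^{1/3} + π²√τ)))) ≤ (1/256)·((2π/b)^α·M_ε)`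
(✓`tail_absorb`; `K(c) ≤ π⁴·(2C₃+1)·331200⁴·L²⁴` for `b ≥ 1`, `b^{3/4} ≥ √b ≥ Y`). [folklore] -/
theorem tailPart_le (CT : ℝ) {QT : ℝ} (hQT : 0 < QT) (pT qT : ℕ) :
    ∃ KT : ℝ, 0 < KT ∧ ∃ kT : ℕ, ∀ (L : ℕ) [NeZero L] (ε : GnoSign L), GoodSign ε → ∀ τ : ℝ, 0 < τ → τ ≤ 1 / 2 →
      ∀ b : ℝ, KT * (L : ℝ) ^ kT * τ⁻¹ ^ kT ≤ b →
        stiffKappa L (1 / 8) * (coneConst * Real.pi *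
          ((Real.pi ^ 2 / (b / (6 * (55200 * (L : ℝ) ^ 6))) * (Real.pi ^ 2 / (b / (6 * (55200 * (L : ℝ) ^ 6)))) *
              (2 * (∫ w : EuclideanSpace ℝ (Fin 3), ((1 + ‖w‖ ^ 2) ^ 2)⁻¹) /
                ((1 + b / (6 * (55200 * (L : ℝ) ^ 6))) * Real.sqrt (1 + b / (6 * (55200 * (L : ℝ) ^ 6)))))) *
            (Real.exp (CT * (L : ℝ) ^ pT - b * τ ^ qT / (QT * (L : ℝ) ^ pT)) * (36 * (Real.sqrt τ) ^ (1 / 3 : ℝ) + Real.pi ^ 2 * Real.sqrt τ)))) ≤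
          (1 / 256 : ℝ) * ((2 * Real.pi / b) ^ alpha L * ∫ a in HubBulk τ, (∫ p : ℝ × ℝ, mbDensity (L := L) a ε p) ∂coneMeasure) := by
  obtain ⟨C3, hC3def⟩ : ∃ C3 : ℝ, C3 = ∫ w : EuclideanSpace ℝ (Fin 3), ((1 + ‖w‖ ^ 2) ^ 2)⁻¹ := ⟨_, rfl⟩
  have hC3 : 0 ≤ C3 := by rw [hC3def]; exact integral_nonneg fun w => by positivity
  obtain ⟨cH, hcH⟩ : ∃ cH : ℝ, cH = coneMeasure.real (HubBulk (1 / 2)) := ⟨_, rfl⟩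
  have hcc : 0 < coneConst * Real.pi := mul_pos coneConst_pos Real.pi_pos
  obtain ⟨W₀, hW₀⟩ : ∃ W₀ : ℝ, W₀ = 40 + |Real.log cH| + 183602 + 6 + 9 * (coneConst * Real.pi) * (Real.pi ^ 4 * (2 * C3 + 1) * 331200 ^ 4) * 46 + |CT| :=
    ⟨_, rfl⟩
  have hW₀0 : 0 ≤ W₀ := by rw [hW₀]; positivity
  refine ⟨(1 + W₀ * QT) ^ 2, by positivity, 2 * (28 + 2 * pT) + 2 * qT, fun L _ ε hε τ hτ hτ2 b hb => ?_⟩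
  obtain ⟨hL1, -, -, -, -⟩ := cell_sizes (L := L)
  have hL0 : (0 : ℝ) < L := by linarith
  have hτ1 : τ ≤ 1 := by linarith
  have hτi1 : 1 ≤ τ⁻¹ := by rw [one_le_inv₀ hτ]; exact hτ1
  -- thresholds: `1 ≤ b` and `Y² ≤ b`
  have hKT1 : (1 : ℝ) ≤ (1 + W₀ * QT) ^ 2 := by nlinarith [mul_nonneg hW₀0 hQT.le]
  have hb1 : 1 ≤ b := by
    have h1 : (1 : ℝ) ≤ (L : ℝ) ^ (2 * (28 + 2 * pT) + 2 * qT) := one_le_pow₀ hL1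
    have h2 : (1 : ℝ) ≤ τ⁻¹ ^ (2 * (28 + 2 * pT) + 2 * qT) := one_le_pow₀ hτi1
    calc (1 : ℝ) = 1 * 1 * 1 := by ring
      _ ≤ (1 + W₀ * QT) ^ 2 * (L : ℝ) ^ (2 * (28 + 2 * pT) + 2 * qT) * τ⁻¹ ^ (2 * (28 + 2 * pT) + 2 * qT) :=
          mul_le_mul (mul_le_mul hKT1 h1 zero_le_one (by positivity)) h2 zero_le_one (by positivity)
      _ ≤ b := hb
  have hb0 : 0 < b := by linarith
  obtain ⟨Y, hY⟩ : ∃ Y : ℝ, Y = W₀ * QT * (L : ℝ) ^ (28 + 2 * pT) * τ⁻¹ ^ qT := ⟨_, rfl⟩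
  have hY0 : 0 ≤ Y := by rw [hY]; positivity
  have hY2b : Y ^ 2 ≤ b := by
    refine le_trans ?_ hb
    have e : Y ^ 2 = (W₀ * QT) ^ 2 * (L : ℝ) ^ (2 * (28 + 2 * pT)) * τ⁻¹ ^ (2 * qT) := by rw [hY]; ring
    rw [e]
    have h1 : (W₀ * QT) ^ 2 ≤ (1 + W₀ * QT) ^ 2 := pow_le_pow_left₀ (mul_nonneg hW₀0 hQT.le) (by linarith) 2
    exact mul_le_mul (mul_le_mul h1 (pow_le_pow_right₀ hL1 (by omega)) (by positivity) (by positivity))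
      (pow_le_pow_right₀ hτi1 (by omega)) (by positivity) (by positivity)
  have hYb : Y ≤ b ^ (3 / 4 : ℝ) := by
    have h1 : Y ≤ Real.sqrt b := by rw [← Real.sqrt_sq hY0]; exact Real.sqrt_le_sqrt hY2b
    have h2 : Real.sqrt b ≤ b ^ (3 / 4 : ℝ) := by rw [Real.sqrt_eq_rpow]; exact Real.rpow_le_rpow_of_exponent_le hb1 (by norm_num)
    exact h1.trans h2
  -- the factor bounds
  have hκle : stiffKappa L (1 / 8) ≤ 9 * (L : ℝ) ^ 4 := by unfold stiffKappa; nlinarith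
  have hκc1 : (1 : ℝ) ≤ 6 * (55200 * (L : ℝ) ^ 6) := by nlinarith [one_le_pow₀ (n := 6) hL1]
  have hKc0 : 0 ≤ Real.pi ^ 2 / (b / (6 * (55200 * (L : ℝ) ^ 6))) * (Real.pi ^ 2 / (b / (6 * (55200 * (L : ℝ) ^ 6)))) *
      (2 * C3 / ((1 + b / (6 * (55200 * (L : ℝ) ^ 6))) * Real.sqrt (1 + b / (6 * (55200 * (L : ℝ) ^ 6))))) := by positivity
  have hβ1 : b⁻¹ * b⁻¹ * (b * Real.sqrt b)⁻¹ ≤ 1 := by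
    have h1 : b⁻¹ ≤ 1 := inv_le_one_of_one_le₀ hb1
    have h2 : (b * Real.sqrt b)⁻¹ ≤ 1 := inv_le_one_of_one_le₀ (by nlinarith [Real.one_le_sqrt.2 hb1])
    calc b⁻¹ * b⁻¹ * (b * Real.sqrt b)⁻¹ ≤ 1 * 1 * 1 := mul_le_mul (mul_le_mul h1 h1 (by positivity) zero_le_one) h2 (by positivity) (by norm_num)
      _ = 1 := by ring
  have hKcle : Real.pi ^ 2 / (b / (6 * (55200 * (L : ℝ) ^ 6))) * (Real.pi ^ 2 / (b / (6 * (55200 * (L : ℝ) ^ 6)))) *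
      (2 * C3 / ((1 + b / (6 * (55200 * (L : ℝ) ^ 6))) * Real.sqrt (1 + b / (6 * (55200 * (L : ℝ) ^ 6))))) ≤
      Real.pi ^ 4 * (2 * C3 + 1) * 331200 ^ 4 * (L : ℝ) ^ 24 := by
    have h := leaderK_common_le (C := C3) hb0 hκc1 hC3
    have hκc4 : (6 * (55200 * (L : ℝ) ^ 6)) ^ 4 = 331200 ^ 4 * (L : ℝ) ^ 24 := by ring
    have hκc40 : 0 ≤ (6 * (55200 * (L : ℝ) ^ 6)) ^ 4 := by positivity
    refine h.trans ?_
    calc (Real.pi ^ 4 * (2 * C3) * (6 * (55200 * (L : ℝ) ^ 6)) ^ 4) * (b⁻¹ * b⁻¹ * (b * Real.sqrt b)⁻¹)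
        ≤ (Real.pi ^ 4 * (2 * C3) * (6 * (55200 * (L : ℝ) ^ 6)) ^ 4) * 1 := mul_le_mul_of_nonneg_left hβ1 (by positivity)
      _ ≤ (Real.pi ^ 4 * (2 * C3 + 1) * (6 * (55200 * (L : ℝ) ^ 6)) ^ 4) * 1 := by nlinarith [mul_nonneg (pow_pos Real.pi_pos 4).le hκc40]
      _ = Real.pi ^ 4 * (2 * C3 + 1) * 331200 ^ 4 * (L : ℝ) ^ 24 := by rw [hκc4]; ring
  have hs1 : Real.sqrt τ ≤ 1 := by rw [← Real.sqrt_one]; exact Real.sqrt_le_sqrt hτ1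
  have hSgle : 36 * (Real.sqrt τ) ^ (1 / 3 : ℝ) + Real.pi ^ 2 * Real.sqrt τ ≤ 46 := by
    have h1 : (Real.sqrt τ) ^ (1 / 3 : ℝ) ≤ 1 := Real.rpow_le_one (Real.sqrt_nonneg _) hs1 (by norm_num)
    have h2 : Real.pi ^ 2 ≤ 10 := by nlinarith [Real.pi_lt_d2, Real.pi_pos]
    have h3 := mul_le_mul_of_nonneg_left h1 (by norm_num : (0:ℝ) ≤ 36)
    have h4 := mul_le_mul_of_nonneg_left hs1 (pow_pos Real.pi_pos 2).le
    linarith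
  have hSg0 : 0 ≤ 36 * (Real.sqrt τ) ^ (1 / 3 : ℝ) + Real.pi ^ 2 * Real.sqrt τ :=
    add_nonneg (mul_nonneg (by norm_num) (Real.rpow_nonneg (Real.sqrt_nonneg _) _)) (by positivity)
  -- the threshold in `tail_absorb`'s shape
  have hW : 4 * (9 * (L : ℝ) ^ 4 + 1) + (|Real.log (coneMeasure.real (HubBulk (1 / 2)))| + 183602 * (L : ℝ) ^ 8 +
      (6 + 9 * (L : ℝ) ^ 4 * (coneConst * Real.pi) * (Real.pi ^ 4 * (2 * C3 + 1) * 331200 ^ 4 * (L : ℝ) ^ 24) * 46 + |CT| * (L : ℝ) ^ pT)) ≤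
      W₀ * (L : ℝ) ^ (28 + pT) := by
    rw [← hcH, hW₀]
    have hLp : (1 : ℝ) ≤ (L : ℝ) ^ (28 + pT) := one_le_pow₀ hL1
    have hL4le : (L : ℝ) ^ 4 ≤ (L : ℝ) ^ (28 + pT) := pow_le_pow_right₀ hL1 (by omega)
    have hL8le : (L : ℝ) ^ 8 ≤ (L : ℝ) ^ (28 + pT) := pow_le_pow_right₀ hL1 (by omega)
    have hLple : (L : ℝ) ^ pT ≤ (L : ℝ) ^ (28 + pT) := pow_le_pow_right₀ hL1 (by omega)
    have hL28 : (L : ℝ) ^ 4 * (L : ℝ) ^ 24 ≤ (L : ℝ) ^ (28 + pT) := by rw [← pow_add]; exact pow_le_pow_right₀ hL1 (by omega)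
    have a1 := abs_nonneg (Real.log cH)
    have a2 := abs_nonneg CT
    have hq0 : 0 ≤ 9 * (coneConst * Real.pi) * (Real.pi ^ 4 * (2 * C3 + 1) * 331200 ^ 4) * 46 := by positivity
    have e : 9 * (L : ℝ) ^ 4 * (coneConst * Real.pi) * (Real.pi ^ 4 * (2 * C3 + 1) * 331200 ^ 4 * (L : ℝ) ^ 24) * 46 =
        (9 * (coneConst * Real.pi) * (Real.pi ^ 4 * (2 * C3 + 1) * 331200 ^ 4) * 46) * ((L : ℝ) ^ 4 * (L : ℝ) ^ 24) := by ring
    rw [e]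
    nlinarith [mul_le_mul_of_nonneg_left hLp a1, mul_le_mul_of_nonneg_left hLple a2, mul_le_mul_of_nonneg_left hL28 hq0,
      mul_le_mul_of_nonneg_left hL4le (by norm_num : (0:ℝ) ≤ 36), mul_le_mul_of_nonneg_left hL8le (by norm_num : (0:ℝ) ≤ 183602)]
  have hXge : b ^ (1 / 4 : ℝ) * (4 * (9 * (L : ℝ) ^ 4 + 1) + (|Real.log (coneMeasure.real (HubBulk (1 / 2)))| + 183602 * (L : ℝ) ^ 8 +
      (6 + 9 * (L : ℝ) ^ 4 * (coneConst * Real.pi) * (Real.pi ^ 4 * (2 * C3 + 1) * 331200 ^ 4 * (L : ℝ) ^ 24) * 46 + |CT| * (L : ℝ) ^ pT))) ≤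
      b * τ ^ qT / (QT * (L : ℝ) ^ pT) := by
    have hq0 : 0 ≤ b ^ (1 / 4 : ℝ) := Real.rpow_nonneg hb0.le _
    have hsplit : b = b ^ (1 / 4 : ℝ) * b ^ (3 / 4 : ℝ) := by rw [← Real.rpow_add hb0]; norm_num
    have hkey : W₀ * (L : ℝ) ^ (28 + pT) ≤ b ^ (3 / 4 : ℝ) * (τ ^ qT / (QT * (L : ℝ) ^ pT)) := by
      rw [mul_div_assoc', le_div_iff₀ (by positivity)]
      have e : W₀ * (L : ℝ) ^ (28 + pT) * (QT * (L : ℝ) ^ pT) = Y * τ ^ qT := by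
        rw [hY]
        have hτq : τ⁻¹ ^ qT * τ ^ qT = 1 := by rw [← mul_pow, inv_mul_cancel₀ hτ.ne', one_pow]
        calc W₀ * (L : ℝ) ^ (28 + pT) * (QT * (L : ℝ) ^ pT) = W₀ * QT * (L : ℝ) ^ (28 + 2 * pT) * 1 := by ring
          _ = W₀ * QT * (L : ℝ) ^ (28 + 2 * pT) * (τ⁻¹ ^ qT * τ ^ qT) := by rw [hτq]
          _ = W₀ * QT * (L : ℝ) ^ (28 + 2 * pT) * τ⁻¹ ^ qT * τ ^ qT := by ring
      rw [e]
      exact mul_le_mul_of_nonneg_right hYb (by positivity)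
    calc b ^ (1 / 4 : ℝ) * _ ≤ b ^ (1 / 4 : ℝ) * (W₀ * (L : ℝ) ^ (28 + pT)) := mul_le_mul_of_nonneg_left hW hq0
      _ ≤ b ^ (1 / 4 : ℝ) * (b ^ (3 / 4 : ℝ) * (τ ^ qT / (QT * (L : ℝ) ^ pT))) := mul_le_mul_of_nonneg_left hkey hq0
      _ = b * τ ^ qT / (QT * (L : ℝ) ^ pT) := by rw [← mul_assoc, ← hsplit]; ring
  rw [hC3def] at hKc0 hKcle hXge
  exact tail_absorb hε hτ hτ2 hb1 hκle hKc0 hKcle hSg0 hSgle hXge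

end Summit.QuantumFields.YangMills.Theorems.SwapVirialDeficit.SectorLaplace

end
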